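import Summits.QuantumFields.BalabanUV.Beta.EriceFlowEnclosureB12AsPrintedHistoryUnique
import Literature.MathematicalPhysics.QuantumFieldTheory.Balaban1983to89.B14

/-!
# Beta / EriceFlowEnclosureB12AsPrintedHistoryUniqueMono — «g₀ = g₀(ε, g)» IS A STRICTLY INCREASING FUNCTION OF g in the history reading of
# [I]: the ORDER of two same-length runs is preserved backward under fading-memory history moduli (β-flow team, prover 1 = recursion ∕ upper ∕
# bare-coupling ∕ uniqueness side, unit `b2b-balaban-beta-bflow-p1`, gen 33; ROW AP-I × ROW U; PART 1 = `…B12AsPrintedHistoryUnique` (uniqueness);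
# companions #14 `…ODEFlow.bareCoupling_wellDefined_of_ode361` («<» preserved in the continuum picture), #26 `…MaximalTuning` (the maximal
# selection is strictly increasing, Markov), `T4CouplingMatching` (node U2's moduli and kernels))

HONEST FRAMING (page 1 of everything the β sub-cell writes): discharging `BetaPertH` makes Bałaban's UV stability UNCONDITIONAL — a
real constructive-QFT result; it is NOT the continuum limit and NOT the Clay problem.  HONEST DEPENDENCY (cell reorg 2026-08-19,
verbatim): «continuum YM on T⁴ ⇐ BetaPertH ∧ nine spine estimates (0/9 proved); BetaPertH ⇐ (D1) ∧ (D4) ∧ CAP+tail; G-an2-4 gates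
asym, D1 and NE2/3/4.»  THIS MODULE DISCHARGES NOTHING: finite-sum bookkeeping from the NAMED FIELDS of `B12BetaAsPrinted` ([Balaban1987RG1]
as typed, p537882 ✓ ∕ v1.1 p539116 ✓) under node U2's HYPOTHESIS SHAPES `HistLipschitz Λ γ β`, `FadingMemory C θ Λ` (NOT printed; [I] p. 298)
and the AF letter (UNPRINTED; Theorem 2 stated without proof, p. 259).  Nothing of Bałaban's objects is asserted.

THE MECHANISM.  Two runs g, g′ of (0.20), K steps, same β, couplings in ]0, γ]; Δ_j := 1∕g_j² − 1∕g′_j² (SIGNED).  (0.20) gives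
Δ_j = Δ_{j+1} + (β_{j+1}(p_j) − β_{j+1}(p′_j)) and the moduli give |β_{j+1}(p_j) − β_{j+1}(p′_j)| ≤ C Σ_{i≤j} θ^{j−i}·(g_i² g′_i)·|Δ_i|.  With
M := max_{i≤K} |Δ_i| and the exchanged double sum Σ_{m<K} Σ_{i≤m} θ^{m−i} u_i ≤ U∕(1 − θ) (`double_sum_le`): (i) |Δ_j| ≤ |Δ_K| + C·M·U∕(1 − θ),
so M ≤ 2|Δ_K| under C·U ≤ (1 − θ)∕2 (`sup_disc_le`); (ii) Δ_j ≥ Δ_K − C·M·U∕(1 − θ) ≥ Δ_K − |Δ_K| (`signed_lower`).  Hence Δ_K ≥ 0 ⟹ Δ_j ≥ 0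
for all j: **the order of the renormalized couplings is the order of all couplings, in particular of the bare ones** (`runs_ordered_of_fadingMemory`);
with PART 1's uniqueness (or forward determinism) the order is STRICT.  On the carrier (§14): `bareCoupling_mono_of_fadingMemory` and the END
**`theorem2_bareCoupling_strictMono`** — under `Theorem2Statement` + `Definitions` + (U) + AF + fading-memory moduli, for small γ, small
renormalized couplings g < g̃ and every K, the tuned bare couplings satisfy g₀(ε, g) < g₀(ε, g̃): «g₀ = g₀(ε, g)» is a STRICTLY INCREASING
FUNCTION of g on every lattice (the history-reading twin of row U's monotone selection, #26, and of the continuum «<»-preservation, #14).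

WHAT THIS FILE PROVES (0 sorry, 0 def):
§13 `geom_tail_le`, **`double_sum_le`**, `signed_step`, `sup_disc_le`, `signed_lower`, **`runs_ordered_of_fadingMemory`**.
§14 `bareCoupling_mono_of_fadingMemory`, `bareCoupling_strictMono_of_fadingMemory`, **`theorem2_bareCoupling_strictMono`**.
NOT CLAIMED: any modulus, sign or bound for Bałaban's β; Theorem 2; `BetaPertH`; continuum; Clay.
-/

namespace Summit.QuantumFields.BalabanUV.Beta.EriceFlowEnclosureB12AsPrintedHistoryUniqueMono

open Finset
open Literature.MathematicalPhysics.QuantumFieldTheory.Balaban1983to89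
open Literature.MathematicalPhysics.QuantumFieldTheory.Balaban1983to89.B12BetaAsPrinted
open Literature.MathematicalPhysics.QuantumFieldTheory.Balaban1983to89.FlowStep (prefixOf Box mem_box box_mono RGEqH BetaLowerH
  BetaUpperH inv_sq_telescopeH)
open Literature.MathematicalPhysics.QuantumFieldTheory.Balaban1983to89.T4CouplingMatching (HistLipschitz FadingMemory
  abs_sub_le_of_inv_sq)
open Summit.QuantumFields.BalabanUV.Beta.EriceFlowEnclosureB12AsPrintedUpper (tunedRuns_of_theorem2Statement)
open Summit.QuantumFields.BalabanUV.Beta.EriceFlowEnclosureB12AsPrintedTunedUpper (hrg_of_betaUpperH)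
open Summit.QuantumFields.BalabanUV.Beta.EriceFlowEnclosureB12AsPrintedHistoryUnique (hist_step sum_weights_le
  bareCoupling_unique_of_fadingMemory)

noncomputable section

variable {S : Setting}

/-! ## §13 The order of two same-length runs is preserved backward -/

/-- A shifted geometric tail: Σ_{m ∈ [i, K)} θ^{m−i} ≤ 1∕(1 − θ) for 0 ≤ θ < 1 (`B14.geomStep_245` after reindexing). [folklore] -/
theorem geom_tail_le {θ : ℝ} (hθ0 : 0 ≤ θ) (hθ1 : θ < 1) (i K : ℕ) :
    ∑ m ∈ Ico i K, θ ^ (m - i) ≤ 1 / (1 - θ) := by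
  rw [Finset.sum_Ico_eq_sum_range (fun m => θ ^ (m - i)) i K]
  have h := B14.geomStep_245 θ hθ0 hθ1 (K - i)
  simp only [Nat.add_sub_cancel_left] at *
  rw [one_div]
  exact h

/-- **The exchanged double sum**: for u ≥ 0 and 0 ≤ θ < 1, Σ_{m<K} Σ_{i≤m} θ^{m−i} u_i = Σ_{i<K} u_i Σ_{m∈[i,K)} θ^{m−i} ≤ (Σ_{i<K} u_i)∕(1 − θ).
[folklore] -/
theorem double_sum_le {θ : ℝ} (hθ0 : 0 ≤ θ) (hθ1 : θ < 1) {u : ℕ → ℝ} {K : ℕ} (hu : ∀ i, i < K → 0 ≤ u i) :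
    ∑ m ∈ range K, ∑ i ∈ range (m + 1), θ ^ (m - i) * u i ≤ (∑ i ∈ range K, u i) * (1 / (1 - θ)) := by
  rw [Finset.sum_comm' (s' := fun i => Ico i K) (t' := range K)
    (h := fun m i => by simp only [mem_range, mem_Ico]; omega)]
  rw [Finset.sum_mul]
  refine Finset.sum_le_sum fun i hi => ?_
  have hiK : i < K := mem_range.mp hi
  calc ∑ m ∈ Ico i K, θ ^ (m - i) * u i = (∑ m ∈ Ico i K, θ ^ (m - i)) * u i := by rw [Finset.sum_mul]
    _ ≤ (1 / (1 - θ)) * u i := mul_le_mul_of_nonneg_right (geom_tail_le hθ0 hθ1 i K) (hu i hiK)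
    _ = u i * (1 / (1 - θ)) := mul_comm _ _

/-- The SIGNED one-step identity with the modulus bound: Δ_j ≥ Δ_{j+1} − Σ_{i≤j} Λ j i·(g_i² g′_i)·|Δ_i|. [cite: Balaban1987RG1, (0.20) p.256 with p.298] -/
theorem signed_step {γ : ℝ} {Λ : ℕ → ℕ → ℝ} {K : ℕ} {g g' : ℕ → ℝ}
    (hg : RGEqH K S.β g) (hg' : RGEqH K S.β g')
    (hbox : ∀ i, i ≤ K → 0 < g i ∧ g i ≤ γ) (hbox' : ∀ i, i ≤ K → 0 < g' i ∧ g' i ≤ γ)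
    (hL : HistLipschitz Λ γ S.β) (hΛ : ∀ k i, i ≤ k → 0 ≤ Λ k i) {j : ℕ} (hj : j < K) :
    (1 / (g (j + 1)) ^ 2 - 1 / (g' (j + 1)) ^ 2)
      - ∑ i ∈ range (j + 1), Λ j i * ((g i) ^ 2 * g' i) * |1 / (g i) ^ 2 - 1 / (g' i) ^ 2|
      ≤ 1 / (g j) ^ 2 - 1 / (g' j) ^ 2 := by
  have e := hg j hj
  have e' := hg' j hj
  have hp : prefixOf g j ∈ Box γ j := T4CouplingMatching.prefixOf_mem_box hj.le hbox
  have hp' : prefixOf g' j ∈ Box γ j := T4CouplingMatching.prefixOf_mem_box hj.le hbox'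
  have h2 := hL j (prefixOf g j) (prefixOf g' j) hp hp'
  have h3 : ∑ i : Fin (j + 1), Λ j i * |prefixOf g j i - prefixOf g' j i|
      ≤ ∑ i ∈ range (j + 1), Λ j i * ((g i) ^ 2 * g' i) * |1 / (g i) ^ 2 - 1 / (g' i) ^ 2| := by
    rw [Finset.sum_range (fun i => Λ j i * ((g i) ^ 2 * g' i) * |1 / (g i) ^ 2 - 1 / (g' i) ^ 2|)]
    refine Finset.sum_le_sum fun i _ => ?_
    have hiK : (i : ℕ) ≤ K := by have := i.isLt; omega
    simp only [FlowStep.prefixOf_apply]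
    rw [mul_assoc]
    exact mul_le_mul_of_nonneg_left (abs_sub_le_of_inv_sq (hbox i hiK).1 (hbox' i hiK).1)
      (hΛ j i (Nat.lt_succ_iff.mp i.isLt))
  have hb : -(S.β j (prefixOf g j) - S.β j (prefixOf g' j)) ≤ |S.β j (prefixOf g j) - S.β j (prefixOf g' j)| := neg_le_abs _
  rw [e, e']
  linarith

/-- **THE GLOBAL MAXIMUM IS CONTROLLED BY THE PIN DISCREPANCY**: with M := max_{i≤K} |Δ_i|, fading memory and the weight sum Σ_{i≤K} g_i² g′_i ≤ U,
every |Δ_j| ≤ |Δ_K| + C·U∕(1 − θ)·M; hence under C·U ≤ (1 − θ)∕2: M ≤ 2|Δ_K|. [folklore] -/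
theorem sup_disc_le {γ θ C U : ℝ} {Λ : ℕ → ℕ → ℝ} {K : ℕ} {g g' : ℕ → ℝ}
    (hθ0 : 0 < θ) (hθ1 : θ < 1) (hC : 0 ≤ C)
    (hg : RGEqH K S.β g) (hg' : RGEqH K S.β g')
    (hbox : ∀ i, i ≤ K → 0 < g i ∧ g i ≤ γ) (hbox' : ∀ i, i ≤ K → 0 < g' i ∧ g' i ≤ γ)
    (hL : HistLipschitz Λ γ S.β) (hΛ : FadingMemory C θ Λ)
    (hU : ∑ i ∈ range (K + 1), (g i) ^ 2 * g' i ≤ U) (hsmall : C * U ≤ (1 - θ) / 2) :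
    ∀ j, j ≤ K → |1 / (g j) ^ 2 - 1 / (g' j) ^ 2| ≤ 2 * |1 / (g K) ^ 2 - 1 / (g' K) ^ 2| ∧
      C * (∑ m ∈ range K, ∑ i ∈ range (m + 1), θ ^ (m - i) * ((g i) ^ 2 * g' i) * |1 / (g i) ^ 2 - 1 / (g' i) ^ 2|)
        ≤ |1 / (g K) ^ 2 - 1 / (g' K) ^ 2| := by
  have hu : ∀ i, i ≤ K → 0 ≤ (g i) ^ 2 * g' i := fun i hi => mul_nonneg (sq_nonneg _) (hbox' i hi).1.le
  have hne : (range (K + 1)).Nonempty := ⟨0, by simp⟩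
  obtain ⟨i₀, hi₀, hMeq⟩ := Finset.exists_mem_eq_sup' hne (fun i => |1 / (g i) ^ 2 - 1 / (g' i) ^ 2|)
  have hi₀K : i₀ ≤ K := Nat.lt_succ_iff.mp (mem_range.mp hi₀)
  -- M := the maximal discrepancy, attained at i₀
  have hMi : ∀ i, i ≤ K → |1 / (g i) ^ 2 - 1 / (g' i) ^ 2| ≤ |1 / (g i₀) ^ 2 - 1 / (g' i₀) ^ 2| := by
    intro i hi
    have h := Finset.le_sup' (fun i => |1 / (g i) ^ 2 - 1 / (g' i) ^ 2|) (mem_range.mpr (Nat.lt_succ_of_le hi))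
    rw [hMeq] at h
    exact h
  set M : ℝ := |1 / (g i₀) ^ 2 - 1 / (g' i₀) ^ 2| with hM
  have hM0 : 0 ≤ M := abs_nonneg _
  have h1θ : 0 < 1 - θ := by linarith
  -- the feedback at step m is ≤ C·M·Σ_{i≤m} θ^{m−i} u_i
  have hfb : ∀ m, m < K → ∑ i ∈ range (m + 1), Λ m i * ((g i) ^ 2 * g' i) * |1 / (g i) ^ 2 - 1 / (g' i) ^ 2|
      ≤ C * M * ∑ i ∈ range (m + 1), θ ^ (m - i) * ((g i) ^ 2 * g' i) := by
    intro m hm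
    rw [Finset.mul_sum]
    refine Finset.sum_le_sum fun i hi => ?_
    have him : i ≤ m := Nat.lt_succ_iff.mp (mem_range.mp hi)
    have hiK : i ≤ K := by omega
    calc Λ m i * ((g i) ^ 2 * g' i) * |1 / (g i) ^ 2 - 1 / (g' i) ^ 2| ≤ (C * θ ^ (m - i)) * ((g i) ^ 2 * g' i) * M := by
          apply mul_le_mul (mul_le_mul_of_nonneg_right (hΛ m i him).2 (hu i hiK)) (hMi i hiK) (abs_nonneg _)
          exact mul_nonneg (mul_nonneg hC (pow_nonneg hθ0.le _)) (hu i hiK)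
      _ = C * M * (θ ^ (m - i) * ((g i) ^ 2 * g' i)) := by ring
  -- the exchanged double sum is ≤ U∕(1 − θ)
  have hW : ∑ m ∈ range K, ∑ i ∈ range (m + 1), θ ^ (m - i) * ((g i) ^ 2 * g' i) ≤ U * (1 / (1 - θ)) := by
    have h1 := double_sum_le hθ0.le hθ1 (K := K) (u := fun i => (g i) ^ 2 * g' i) (fun i hi => hu i hi.le)
    have h2 : ∑ i ∈ range K, (g i) ^ 2 * g' i ≤ U := by
      have : ∑ i ∈ range K, (g i) ^ 2 * g' i ≤ ∑ i ∈ range (K + 1), (g i) ^ 2 * g' i :=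
        Finset.sum_le_sum_of_subset_of_nonneg (Finset.range_subset_range.mpr (Nat.le_succ K))
          (fun i hi _ => hu i (Nat.lt_succ_iff.mp (mem_range.mp hi)))
      exact this.trans hU
    exact h1.trans (mul_le_mul_of_nonneg_right h2 (one_div_nonneg.mpr h1θ.le))
  have hWnn : ∀ m, m ≤ K → 0 ≤ ∑ i ∈ range (m + 1), θ ^ (m - i) * ((g i) ^ 2 * g' i) := fun m hm =>
    Finset.sum_nonneg fun i hi => mul_nonneg (pow_nonneg hθ0.le _) (hu i ((Nat.lt_succ_iff.mp (mem_range.mp hi)).trans hm))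
  have hκ : C * (U * (1 / (1 - θ))) ≤ 1 / 2 := by
    rw [← mul_assoc, mul_one_div, div_le_iff₀ h1θ]
    linarith
  -- (i) unsigned backward bound: δ j ≤ δ K + C·M·Σ_{m∈[j,K)} W_m
  have hback : ∀ d j, j + d = K → |1 / (g j) ^ 2 - 1 / (g' j) ^ 2|
      ≤ |1 / (g K) ^ 2 - 1 / (g' K) ^ 2| + C * M * ∑ m ∈ Ico j K, ∑ i ∈ range (m + 1), θ ^ (m - i) * ((g i) ^ 2 * g' i) := by
    intro d
    induction d with
    | zero => intro j hj; rw [add_zero] at hj; subst hj; simp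
    | succ d ih =>
      intro j hj
      have hjK : j < K := by omega
      have ih' := ih (j + 1) (by omega)
      have hstep := hist_step hg hg' hbox hbox' hL (fun k i hik => (hΛ k i hik).1) hjK
      have hf := hfb j hjK
      rw [Finset.sum_eq_sum_Ico_succ_bot hjK, mul_add]
      linarith [hstep, hf, ih']
  have hCM : 0 ≤ C * M := mul_nonneg hC hM0
  have hMle : M ≤ |1 / (g K) ^ 2 - 1 / (g' K) ^ 2| + C * M * (U * (1 / (1 - θ))) := by
    have hb := hback (K - i₀) i₀ (by omega)
    have hsub : ∑ m ∈ Ico i₀ K, ∑ i ∈ range (m + 1), θ ^ (m - i) * ((g i) ^ 2 * g' i)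
        ≤ ∑ m ∈ range K, ∑ i ∈ range (m + 1), θ ^ (m - i) * ((g i) ^ 2 * g' i) :=
      Finset.sum_le_sum_of_subset_of_nonneg (fun m hm => mem_range.mpr (mem_Ico.mp hm).2)
        fun m hm _ => hWnn m (mem_range.mp hm).le
    have := mul_le_mul_of_nonneg_left (hsub.trans hW) hCM
    calc M = |1 / (g i₀) ^ 2 - 1 / (g' i₀) ^ 2| := hM
      _ ≤ _ := hb
      _ ≤ _ := by linarith
  have hM2 : M ≤ 2 * |1 / (g K) ^ 2 - 1 / (g' K) ^ 2| := by
    have : C * M * (U * (1 / (1 - θ))) ≤ M * (1 / 2) := by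
      calc C * M * (U * (1 / (1 - θ))) = M * (C * (U * (1 / (1 - θ)))) := by ring
        _ ≤ M * (1 / 2) := mul_le_mul_of_nonneg_left hκ hM0
    linarith
  intro j hj
  refine ⟨(hMi j hj).trans hM2, ?_⟩
  -- the weighted feedback sum ≤ C·M·W ≤ δ K
  have hS : ∑ m ∈ range K, ∑ i ∈ range (m + 1), θ ^ (m - i) * ((g i) ^ 2 * g' i) * |1 / (g i) ^ 2 - 1 / (g' i) ^ 2|
      ≤ M * ∑ m ∈ range K, ∑ i ∈ range (m + 1), θ ^ (m - i) * ((g i) ^ 2 * g' i) := by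
    rw [Finset.mul_sum]
    refine Finset.sum_le_sum fun m hm => ?_
    rw [Finset.mul_sum]
    refine Finset.sum_le_sum fun i hi => ?_
    have hiK : i ≤ K := (Nat.lt_succ_iff.mp (mem_range.mp hi)).trans (mem_range.mp hm).le
    calc θ ^ (m - i) * ((g i) ^ 2 * g' i) * |1 / (g i) ^ 2 - 1 / (g' i) ^ 2| ≤ θ ^ (m - i) * ((g i) ^ 2 * g' i) * M :=
          mul_le_mul_of_nonneg_left (hMi i hiK) (mul_nonneg (pow_nonneg hθ0.le _) (hu i hiK))
      _ = M * (θ ^ (m - i) * ((g i) ^ 2 * g' i)) := by ring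
  calc C * ∑ m ∈ range K, ∑ i ∈ range (m + 1), θ ^ (m - i) * ((g i) ^ 2 * g' i) * |1 / (g i) ^ 2 - 1 / (g' i) ^ 2|
      ≤ C * (M * (U * (1 / (1 - θ)))) := mul_le_mul_of_nonneg_left (hS.trans (mul_le_mul_of_nonneg_left hW hM0)) hC
    _ = M * (C * (U * (1 / (1 - θ)))) := by ring
    _ ≤ M * (1 / 2) := mul_le_mul_of_nonneg_left hκ hM0
    _ ≤ |1 / (g K) ^ 2 - 1 / (g' K) ^ 2| := by linarith

/-- **THE SIGNED LOWER BOUND**: Δ_j ≥ Δ_K − C·Σ_{m∈[j,K)} Σ_{i≤m} θ^{m−i} u_i |Δ_i| ≥ Δ_K − |Δ_K|. [folklore] -/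
theorem signed_lower {γ θ C U : ℝ} {Λ : ℕ → ℕ → ℝ} {K : ℕ} {g g' : ℕ → ℝ}
    (hθ0 : 0 < θ) (hθ1 : θ < 1) (hC : 0 ≤ C)
    (hg : RGEqH K S.β g) (hg' : RGEqH K S.β g')
    (hbox : ∀ i, i ≤ K → 0 < g i ∧ g i ≤ γ) (hbox' : ∀ i, i ≤ K → 0 < g' i ∧ g' i ≤ γ)
    (hL : HistLipschitz Λ γ S.β) (hΛ : FadingMemory C θ Λ)
    (hU : ∑ i ∈ range (K + 1), (g i) ^ 2 * g' i ≤ U) (hsmall : C * U ≤ (1 - θ) / 2) :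
    ∀ j, j ≤ K → (1 / (g K) ^ 2 - 1 / (g' K) ^ 2) - |1 / (g K) ^ 2 - 1 / (g' K) ^ 2| ≤ 1 / (g j) ^ 2 - 1 / (g' j) ^ 2 := by
  have hu : ∀ i, i ≤ K → 0 ≤ (g i) ^ 2 * g' i := fun i hi => mul_nonneg (sq_nonneg _) (hbox' i hi).1.le
  have htot := (sup_disc_le hθ0 hθ1 hC hg hg' hbox hbox' hL hΛ hU hsmall K le_rfl).2
  -- feedback at step m ≤ C Σ θ^{m-i} u_i δ_i
  have hfb : ∀ m, m < K → ∑ i ∈ range (m + 1), Λ m i * ((g i) ^ 2 * g' i) * |1 / (g i) ^ 2 - 1 / (g' i) ^ 2|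
      ≤ C * ∑ i ∈ range (m + 1), θ ^ (m - i) * ((g i) ^ 2 * g' i) * |1 / (g i) ^ 2 - 1 / (g' i) ^ 2| := by
    intro m hm
    rw [Finset.mul_sum]
    refine Finset.sum_le_sum fun i hi => ?_
    have him : i ≤ m := Nat.lt_succ_iff.mp (mem_range.mp hi)
    have hiK : i ≤ K := by omega
    have hnn : 0 ≤ (g i) ^ 2 * g' i * |1 / (g i) ^ 2 - 1 / (g' i) ^ 2| := mul_nonneg (hu i hiK) (abs_nonneg _)
    calc Λ m i * ((g i) ^ 2 * g' i) * |1 / (g i) ^ 2 - 1 / (g' i) ^ 2|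
        = Λ m i * ((g i) ^ 2 * g' i * |1 / (g i) ^ 2 - 1 / (g' i) ^ 2|) := by ring
      _ ≤ C * θ ^ (m - i) * ((g i) ^ 2 * g' i * |1 / (g i) ^ 2 - 1 / (g' i) ^ 2|) := mul_le_mul_of_nonneg_right (hΛ m i him).2 hnn
      _ = C * (θ ^ (m - i) * ((g i) ^ 2 * g' i) * |1 / (g i) ^ 2 - 1 / (g' i) ^ 2|) := by ring
  have hWnn : ∀ m, m ≤ K → 0 ≤ ∑ i ∈ range (m + 1), θ ^ (m - i) * ((g i) ^ 2 * g' i) * |1 / (g i) ^ 2 - 1 / (g' i) ^ 2| :=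
    fun m hm => Finset.sum_nonneg fun i hi => mul_nonneg (mul_nonneg (pow_nonneg hθ0.le _)
      (hu i ((Nat.lt_succ_iff.mp (mem_range.mp hi)).trans hm))) (abs_nonneg _)
  -- backward signed induction: Δ_j ≥ Δ_K − C Σ_{m ∈ [j, K)} Σ_i θ^{m−i} u_i δ_i
  have hback : ∀ d j, j + d = K → (1 / (g K) ^ 2 - 1 / (g' K) ^ 2)
      - C * ∑ m ∈ Ico j K, ∑ i ∈ range (m + 1), θ ^ (m - i) * ((g i) ^ 2 * g' i) * |1 / (g i) ^ 2 - 1 / (g' i) ^ 2|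
        ≤ 1 / (g j) ^ 2 - 1 / (g' j) ^ 2 := by
    intro d
    induction d with
    | zero => intro j hj; rw [add_zero] at hj; subst hj; simp
    | succ d ih =>
      intro j hj
      have hjK : j < K := by omega
      have ih' := ih (j + 1) (by omega)
      have hstep := signed_step hg hg' hbox hbox' hL (fun k i hik => (hΛ k i hik).1) hjK
      have hf := hfb j hjK
      rw [Finset.sum_eq_sum_Ico_succ_bot hjK, mul_add]
      linarith [hstep, hf, ih']
  intro j hj
  have hb := hback (K - j) j (by omega)
  have hsub : ∑ m ∈ Ico j K, ∑ i ∈ range (m + 1), θ ^ (m - i) * ((g i) ^ 2 * g' i) * |1 / (g i) ^ 2 - 1 / (g' i) ^ 2|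
      ≤ ∑ m ∈ range K, ∑ i ∈ range (m + 1), θ ^ (m - i) * ((g i) ^ 2 * g' i) * |1 / (g i) ^ 2 - 1 / (g' i) ^ 2| :=
    Finset.sum_le_sum_of_subset_of_nonneg (fun m hm => mem_range.mpr (mem_Ico.mp hm).2) fun m hm _ => hWnn m (mem_range.mp hm).le
  have := mul_le_mul_of_nonneg_left hsub hC
  linarith [hb, this, htot]

/-- **THE ORDER OF THE RENORMALIZED COUPLINGS IS THE ORDER OF ALL COUPLINGS.**  Two runs of (0.20) of the same length K with the same β, couplings
in ]0, γ], history moduli with fading memory, weight sum ≤ U, smallness C·U ≤ (1 − θ)∕2: if g_K ≤ g′_K then g_j ≤ g′_j for every j ≤ K — in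
particular for the BARE couplings.  (Δ_K ≥ 0 ⟹ Δ_K − |Δ_K| = 0 ≤ Δ_j.) [cite: Balaban1987RG1, Thm 2 p.259 («g₀ = g₀(ε, g)») with (0.20) p.256 and p.298] -/
theorem runs_ordered_of_fadingMemory {γ θ C U : ℝ} {Λ : ℕ → ℕ → ℝ} {K : ℕ} {g g' : ℕ → ℝ}
    (hθ0 : 0 < θ) (hθ1 : θ < 1) (hC : 0 ≤ C)
    (hg : RGEqH K S.β g) (hg' : RGEqH K S.β g')
    (hbox : ∀ i, i ≤ K → 0 < g i ∧ g i ≤ γ) (hbox' : ∀ i, i ≤ K → 0 < g' i ∧ g' i ≤ γ)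
    (hL : HistLipschitz Λ γ S.β) (hΛ : FadingMemory C θ Λ)
    (hU : ∑ i ∈ range (K + 1), (g i) ^ 2 * g' i ≤ U) (hsmall : C * U ≤ (1 - θ) / 2) (hle : g K ≤ g' K) :
    ∀ j, j ≤ K → g j ≤ g' j := by
  intro j hj
  have hK := hbox K le_rfl
  have hK' := hbox' K le_rfl
  have hΔK : 0 ≤ 1 / (g K) ^ 2 - 1 / (g' K) ^ 2 :=
    sub_nonneg.mpr (one_div_le_one_div_of_le (pow_pos hK.1 2) (pow_le_pow_left₀ hK.1.le hle 2))
  have h := signed_lower hθ0 hθ1 hC hg hg' hbox hbox' hL hΛ hU hsmall j hj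
  rw [abs_of_nonneg hΔK, sub_self] at h
  have hj0 := hbox j hj
  have hj0' := hbox' j hj
  have hsq : (g j) ^ 2 ≤ (g' j) ^ 2 := (one_div_le_one_div (pow_pos hj0'.1 2) (pow_pos hj0.1 2)).mp (sub_nonneg.mp h)
  exact (pow_le_pow_iff_left₀ hj0.1.le hj0'.1.le two_ne_zero).mp hsq

/-! ## §14 On the carrier: «g₀ = g₀(ε, g)» is strictly increasing in g -/

/-- **THE BARE COUPLING IS MONOTONE IN THE RENORMALIZED ONE** (history reading, fading memory): for a setting with the printed `Definitions`,
two runs (K, m, g₀), (K, m, g₀′) obeying (0.20) inside ]0, γ] with g_K ≤ g′_K have g₀ ≤ g₀′ — under `HistLipschitz` + `FadingMemory`, the AF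
letter `BetaLowerH b γ S.β` and the smallness C(γ³ + 2γ∕b) ≤ (1 − θ)∕2. [cite: Balaban1987RG1, Thm 2 p.259 («g₀ = g₀(ε, g)») with (0.18)–(0.20) pp.255–256 and p.298] -/
theorem bareCoupling_mono_of_fadingMemory (hD : Definitions S) {γ θ C b : ℝ} {Λ : ℕ → ℕ → ℝ}
    (hθ0 : 0 < θ) (hθ1 : θ < 1) (hC : 0 ≤ C) (hγ : 0 < γ) (hb : 0 < b)
    (hL : HistLipschitz Λ γ S.β) (hΛ : FadingMemory C θ Λ) (hlo : BetaLowerH b γ S.β)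
    (hsmall : C * (γ ^ 3 + 2 * γ / b) ≤ (1 - θ) / 2) {K m : ℕ} {g₀ g₀' : ℝ}
    (hrg : RGEqH K S.β (S.cpl ⟨K, m, g₀⟩)) (hrg' : RGEqH K S.β (S.cpl ⟨K, m, g₀'⟩))
    (hI : Step.InInterval γ K (S.cpl ⟨K, m, g₀⟩)) (hI' : Step.InInterval γ K (S.cpl ⟨K, m, g₀'⟩))
    (hle : S.cpl ⟨K, m, g₀⟩ K ≤ S.cpl ⟨K, m, g₀'⟩ K) : g₀ ≤ g₀' := by
  have h := runs_ordered_of_fadingMemory hθ0 hθ1 hC hrg hrg' hI hI' hL hΛ (sum_weights_le hγ hb hrg hrg' hI hI' hlo) hsmall hle 0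
    (Nat.zero_le K)
  rwa [hD.d018, hD.d018] at h

/-- **… AND STRICTLY**: g_K < g′_K ⟹ g₀ < g₀′ (equal bare couplings generate the same run by (0.18)∕(0.20): the two runs are the SAME element of
the setting's coupling table). [cite: Balaban1987RG1, Thm 2 p.259 («g₀ = g₀(ε, g)») with (0.18)–(0.20) pp.255–256] -/
theorem bareCoupling_strictMono_of_fadingMemory (hD : Definitions S) {γ θ C b : ℝ} {Λ : ℕ → ℕ → ℝ}
    (hθ0 : 0 < θ) (hθ1 : θ < 1) (hC : 0 ≤ C) (hγ : 0 < γ) (hb : 0 < b)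
    (hL : HistLipschitz Λ γ S.β) (hΛ : FadingMemory C θ Λ) (hlo : BetaLowerH b γ S.β)
    (hsmall : C * (γ ^ 3 + 2 * γ / b) ≤ (1 - θ) / 2) {K m : ℕ} {g₀ g₀' : ℝ}
    (hrg : RGEqH K S.β (S.cpl ⟨K, m, g₀⟩)) (hrg' : RGEqH K S.β (S.cpl ⟨K, m, g₀'⟩))
    (hI : Step.InInterval γ K (S.cpl ⟨K, m, g₀⟩)) (hI' : Step.InInterval γ K (S.cpl ⟨K, m, g₀'⟩))
    (hlt : S.cpl ⟨K, m, g₀⟩ K < S.cpl ⟨K, m, g₀'⟩ K) : g₀ < g₀' := by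
  have hle := bareCoupling_mono_of_fadingMemory hD hθ0 hθ1 hC hγ hb hL hΛ hlo hsmall hrg hrg' hI hI' hlt.le
  rcases hle.lt_or_eq with h | h
  · exact h
  · exact absurd (by rw [h]) hlt.ne

/-- **END — THEOREM 2's «g₀ = g₀(ε, g)» IS A STRICTLY INCREASING FUNCTION OF g, IN THE HISTORY READING, UNDER FADING MEMORY.**  With the
hypotheses of PART 1's `theorem2_existsUnique_of_fadingMemory` (`Theorem2Statement S hL` — a HYPOTHESIS —, printed `Definitions`, (U) with
b′γ₁² < 1, AF letter b, `HistLipschitz` + `FadingMemory`, C(γ₁³ + 2γ₁∕b) ≤ (1 − θ)∕2): for every m there is γ₂ > 0 such that for every γ ≤ γ₂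
there is g₁ > 0 such that for all renormalized couplings 0 < g < g̃ ≤ g₁ and EVERY K, ANY bare couplings g₀, g̃₀ whose runs stay in ]0, γ] and
end at g resp. g̃ satisfy g₀ < g̃₀ (and such bare couplings exist by Theorem 2).  A REDUCTION over UNPRINTED letters; nothing of [I] asserted.
[cite: Balaban1987RG1, Thm 2 (0.31) p.259 with (0.20) p.256 and p.298] -/
theorem theorem2_bareCoupling_strictMono {hL : Odd S.L ∧ 1 < S.L} (h : Theorem2Statement S hL) (hD : Definitions S)
    {γu γ₁ b b' θ C : ℝ} {Λ : ℕ → ℕ → ℝ} (hup : BetaUpperH b' γu S.β) (hlo : BetaLowerH b γu S.β) (hb : 0 < b)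
    (hL' : HistLipschitz Λ γu S.β) (hΛ : FadingMemory C θ Λ) (hθ0 : 0 < θ) (hθ1 : θ < 1) (hC : 0 ≤ C)
    (hγ₁ : 0 < γ₁) (hγ₁u : γ₁ ≤ γu) (hbu : b' * γ₁ ^ 2 < 1) (hsmall : C * (γ₁ ^ 3 + 2 * γ₁ / b) ≤ (1 - θ) / 2) (m : ℕ) :
    ∃ γ₂ : ℝ, 0 < γ₂ ∧ ∀ γ : ℝ, 0 < γ → γ ≤ γ₂ → ∃ g₁ : ℝ, 0 < g₁ ∧ ∀ g gt : ℝ, 0 < g → g < gt → gt ≤ g₁ → ∀ K : ℕ,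
      (∃ g₀ : ℝ, Step.InInterval γ K (S.cpl ⟨K, m, g₀⟩) ∧ S.cpl ⟨K, m, g₀⟩ K = g) ∧
      (∃ gt₀ : ℝ, Step.InInterval γ K (S.cpl ⟨K, m, gt₀⟩) ∧ S.cpl ⟨K, m, gt₀⟩ K = gt) ∧
      ∀ g₀ gt₀ : ℝ, Step.InInterval γ K (S.cpl ⟨K, m, g₀⟩) → S.cpl ⟨K, m, g₀⟩ K = g →
        Step.InInterval γ K (S.cpl ⟨K, m, gt₀⟩) → S.cpl ⟨K, m, gt₀⟩ K = gt → g₀ < gt₀ := by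
  obtain ⟨γ₀, hγ₀, hγ⟩ := tunedRuns_of_theorem2Statement h m
  refine ⟨min γ₀ γ₁, lt_min hγ₀ hγ₁, fun γ hγpos hγle => ?_⟩
  have hγ₀le : γ ≤ γ₀ := hγle.trans (min_le_left _ _)
  have hγ₁le : γ ≤ γ₁ := hγle.trans (min_le_right _ _)
  have hγule : γ ≤ γu := hγ₁le.trans hγ₁u
  obtain ⟨g₁, hg₁, hg⟩ := hγ γ hγpos hγ₀le
  refine ⟨g₁, hg₁, fun g gt hgpos hlt hgtle K => ?_⟩
  have hgle : g ≤ g₁ := hlt.le.trans hgtle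
  have hgtpos : 0 < gt := hgpos.trans hlt
  obtain ⟨β, β', -, -, hK⟩ := hg g hgpos hgle
  obtain ⟨g₀, hI, hend, -⟩ := hK K
  obtain ⟨βt, βt', -, -, hKt⟩ := hg gt hgtpos hgtle
  obtain ⟨gt₀, hIt, hendt, -⟩ := hKt K
  have hup' : BetaUpperH b' γ S.β := fun k v hv => hup k v (box_mono hγule k hv)
  have hlo' : BetaLowerH b γ S.β := fun k v hv => hlo k v (box_mono hγule k hv)
  have hLγ : HistLipschitz Λ γ S.β := fun k p q hp hq => hL' k p q (box_mono hγule k hp) (box_mono hγule k hq)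
  have hγsq : γ ^ 2 ≤ γ₁ ^ 2 := pow_le_pow_left₀ hγpos.le hγ₁le 2
  have hbγ : b' * γ ^ 2 < 1 := by
    rcases le_or_gt 0 b' with hb' | hb'
    · exact lt_of_le_of_lt (mul_le_mul_of_nonneg_left hγsq hb') hbu
    · nlinarith [sq_nonneg γ]
  have hmono : γ ^ 3 + 2 * γ / b ≤ γ₁ ^ 3 + 2 * γ₁ / b :=
    add_le_add (pow_le_pow_left₀ hγpos.le hγ₁le 3) (div_le_div_of_nonneg_right (by linarith) hb.le)
  have hsmallγ : C * (γ ^ 3 + 2 * γ / b) ≤ (1 - θ) / 2 := (mul_le_mul_of_nonneg_left hmono hC).trans hsmall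
  refine ⟨⟨g₀, hI, hend⟩, ⟨gt₀, hIt, hendt⟩, fun x xt hIx hendx hIxt hendxt => ?_⟩
  exact bareCoupling_strictMono_of_fadingMemory hD hθ0 hθ1 hC hγpos hb hLγ hΛ hlo' hsmallγ
    (hrg_of_betaUpperH hD hγpos hup' hbγ ⟨K, m, x⟩ hIx) (hrg_of_betaUpperH hD hγpos hup' hbγ ⟨K, m, xt⟩ hIxt) hIx hIxt
    (by rw [hendx, hendxt]; exact hlt)

end

end Summit.QuantumFields.BalabanUV.Beta.EriceFlowEnclosureB12AsPrintedHistoryUniqueMono
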